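import Summits.ResolutionOfSingularities.ResolutionOfSingularities.Theorems.WeightedInvariantIota3DominanceWordsDefs
import Summits.ResolutionOfSingularities.ResolutionOfSingularities.Theorems.WeightedInvariantIota3JSigmaCanonicalOf
import Summits.ResolutionOfSingularities.ResolutionOfSingularities.Theorems.WeightedInvariantIota3SigmaLevelBoundOfDominance
import Summits.ResolutionOfSingularities.ResolutionOfSingularities.Theorems.WeightedInvariantIota3TwoFlagCompletion
import HarnessLib

/-!
# W4.3 door 19897 — (σ-pres)₃ AND (J-can)≤3 FROM THE ONE DOMINANCE WORD (PART 2 of 2, def-free): the PROVED reshuffles of SPEC (Δ12) rev 4 through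
# the names of PART 1, with `H` := res-D-brk-1's `Iota3.jSigmaCanonicalAt_of_oneSided`, `hEX` := res-D-pv-036's `sigmaMaximiserExistsLE3_of_dominance`,
# `hx` := res-D-pv-048's `Iota3.exists_span_triple_of_isTwoFlag` ((o70-x)) DISCHARGED BY NAME

**Provenance / honest framing.** VERBATIM PORT of the registrar's SPEC (Δ12) rev 4 `L/res-L1-w43-plan-1/JSigmaCanon_sketch.lean` d065476ee61016ce
(299 l., farm rc 0 · 0 sorries; res-L1-w43-plan-1, W4.3 door `stmt-ResolutionOfSingularities-19897`, (o70-a)/(o70-b)/(σ-pres)₃ bookkeeping), dealt as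
(F-4) (STATUS 2026-08-27T22:25:19Z), ported by res-L1-type-o4, `--supports stmt-ResolutionOfSingularities-19897 --as helper`.  [OURS · L1 W4.3 · SPEC (Δ12)]
Every `def … : Prop` here is an OURS CANDIDATE WORD of the door's bookkeeping (a hypothesis shape consumed by landed theorems — (J-can)≤3 and the
dominance words are OPEN), NOT a statement of H. Hironaka's 2017 manuscript (under adjudication; nothing of it asserted or used), not a Literature
fact, not a claim; every theorem is a PROVED reshuffle over the tree's `flagContactFiltration` / `IsSigmaMaximiser` / `jSigmaPtLocal` / `jFlatT`
calculus.  AI-written and AI-ported, weaker than expert review; candidates stay candidates; no progress claim.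

## Contents
* verbatim from the sketch: `Iota3.jSigmaCanonicalAt_of_dominant`, `Iota3.jSigmaPtLocal_eq_flagContactFiltration_of_canonicalAt`,
  `Iota3.jSigmaPtLocal_eq_weightedMonomialIdeal_of_canonicalAt`, `Iota3.jFlatT_eq_weightedMonomialIdeal_of_canonicalAt`, `sigmaPresentationLE3Body_of_bodies`,
  `Iota3.sigmaOneSidedDominanceAt_of_atLevel`, `sigmaOneSidedDominanceLE3Body_of_atLevel`, `jSigmaCanonicalLE3_of_oneSided_of`, `sigmaPresentationLE3Body_of_atLevel`;
* NEW compositions (registrar's DEAL (F-4) (ii), the binders discharged by landed theorems BY NAME): `Iota3.jSigmaCanonicalAt_of_oneSidedDominanceAt`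
  (= brk-1's theorem read through the defs), `sigmaMaximiserExistsLE3_of_atLevel` (= 036's), **`jSigmaCanonicalLE3_of_atLevel : TwoFlagDominanceAtLevelLE3Body p →
  JSigmaCanonicalLE3Body p`**, **`sigmaPresentationLE3_of_dominance : TwoFlagDominanceAtLevelLE3Body p → SigmaPresentationLE3Body p`** ⇒ RE-ENTRY OBJECT #1
  of CHAIN w43 = «prove `TwoFlagDominanceAtLevelLE3Body p`, import ONE file».
-/

noncomputable section

open IsLocalRing Literature.AlgebraicGeometry.Resolution
open Summit.ResolutionOfSingularities.ResolutionOfSingularities.Theorems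

set_option linter.dupNamespace false

namespace Summit.ResolutionOfSingularities.ResolutionOfSingularities.Cruxes.HypersurfaceCentreConstruction.LocalEngine

namespace Iota3

variable {S : Type} [CommRing S] [IsLocalRing S]

/-- **GLUE (PROVED): unique weights + mutual dominance ⇒ (J-can).** [OURS · SPEC (Δ12)] [folklore] -/
theorem jSigmaCanonicalAt_of_dominant {f : S} (hw : SigmaWeightsUniqueAt f) (hd : SigmaFlagDominantAt f) : JSigmaCanonicalAt f := by
  intro g₁ g₂ q r₁ r₂ g₁' g₂' q' r₁' r₂' hmax hprim hmax' hprim' m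
  obtain ⟨rfl, rfl, rfl⟩ := hw g₁ g₂ q r₁ r₂ g₁' g₂' q' r₁' r₂' hmax hprim hmax' hprim'
  obtain ⟨h₁, h₂⟩ := hd g₁ g₂ q' r₁' r₂' g₁' g₂' hmax hprim hmax'
  obtain ⟨h₁', h₂'⟩ := hd g₁' g₂' q' r₁' r₂' g₁ g₂ hmax' hprim' hmax
  exact flagContactFiltration_eq_of_mem_of_mem hmax.1.1 h₁ h₂ h₁' h₂' m

/-- **`jSigmaPtLocal` IS the filtration of any attaining primitive flag, given (J-can)** (PROVED: the sup of a constant family over a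
nonempty index). [OURS · SPEC (Δ12)] [folklore] -/
theorem jSigmaPtLocal_eq_flagContactFiltration_of_canonicalAt {f : S} (hf0 : f ≠ 0) (hfu : ¬ IsUnit f)
    (hcan : JSigmaCanonicalAt f) {g₁ g₂ : S} {q r₁ r₂ : ℕ} (hmax : IsSigmaMaximiser f (adicOrder f).toNat g₁ g₂ q r₁ r₂)
    (hprim : IsPrimitiveTriple q r₁ r₂) (m : ℕ) :
    jSigmaPtLocal f m = flagContactFiltration g₁ g₂ q r₁ r₂ m := by
  rw [jSigmaPtLocal_of_ne hf0 hfu]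
  refine le_antisymm ?_ ?_
  · exact iSup_le fun g₁' => iSup_le fun g₂' => iSup_le fun q' => iSup_le fun r₁' => iSup_le fun r₂' => iSup_le fun h' =>
      (hcan g₁ g₂ q r₁ r₂ g₁' g₂' q' r₁' r₂' hmax hprim h'.1 h'.2 m).le
  · exact le_iSup_of_le g₁ <| le_iSup_of_le g₂ <| le_iSup_of_le q <| le_iSup_of_le r₁ <| le_iSup_of_le r₂ <|
      le_iSup_of_le ⟨hmax, hprim⟩ le_rfl

/-- **… and hence a WEIGHTED MONOMIAL FILTRATION of the full system `(x, g₂, g₁)` with weights `(q, r₂, r₁)`** (PROVED, res-type-070's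
bridge `flagContactFiltration_eq_weightedMonomialIdeal`). [OURS · SPEC (Δ12)] [cite: Wlodarczyk2022, Lemma 2.1.12] -/
theorem jSigmaPtLocal_eq_weightedMonomialIdeal_of_canonicalAt {f : S} (hf0 : f ≠ 0) (hfu : ¬ IsUnit f)
    (hcan : JSigmaCanonicalAt f) {x g₁ g₂ : S} {q r₁ r₂ : ℕ} (hmax : IsSigmaMaximiser f (adicOrder f).toNat g₁ g₂ q r₁ r₂)
    (hprim : IsPrimitiveTriple q r₁ r₂) (h𝔪 : Ideal.span {x, g₂, g₁} = maximalIdeal S) (m : ℕ) :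
    jSigmaPtLocal f m = weightedMonomialIdeal ![x, g₂, g₁] ![q, r₂, r₁] m := by
  rw [jSigmaPtLocal_eq_flagContactFiltration_of_canonicalAt hf0 hfu hcan hmax hprim m]
  exact flagContactFiltration_eq_weightedMonomialIdeal h𝔪 hmax.1.1 hmax.1.2.1 (hmax.1.2.1.trans hmax.1.2.2) m

/-- **`J₃ᵗ` AT A DIMENSION-3, `ε ≠ 1` POINT-CENTRE POSITION IS A WEIGHTED MONOMIAL FILTRATION, given (EX)-data and (J-can)** — the J-side
presentation AT THE POINT for the bodies `PointBodyLE3 p 0 0` / `p 0 1` (PROVED reshuffle of `jFlatT_eq_jSigmaPt` + the two lemmas above).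
[OURS · SPEC (Δ12)] [folklore] -/
theorem jFlatT_eq_weightedMonomialIdeal_of_canonicalAt {f : S} (hf0 : f ≠ 0) (hfu : ¬ IsUnit f)
    (h : ContactCylinder.topStratumPrime iotaOrdEpsTau S f = maximalIdeal S) (hdim : ¬ ringKrullDim S ≤ 2) (hε : iotaEps S f ≠ 1)
    (hcan : JSigmaCanonicalAt f) {x g₁ g₂ : S} {q r₁ r₂ : ℕ} (hmax : IsSigmaMaximiser f (adicOrder f).toNat g₁ g₂ q r₁ r₂)
    (hprim : IsPrimitiveTriple q r₁ r₂) (h𝔪 : Ideal.span {x, g₂, g₁} = maximalIdeal S) (m : ℕ) :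
    jFlatT S f m = weightedMonomialIdeal ![x, g₂, g₁] ![q, r₂, r₁] m := by
  rw [jFlatT_eq_jSigmaPt S f m h hdim hε, jSigmaPt_eq]
  exact jSigmaPtLocal_eq_weightedMonomialIdeal_of_canonicalAt hf0 hfu hcan hmax hprim h𝔪 m

end Iota3

open Iota3 in
/-- **GLUE (PROVED modulo the r.s.p. completion `hx` = (o70-x)): (o70-a) + (o70-b) ⇒ (σ-pres)₃.**  `hx`: a two-flag of a regular local ring
of dimension `3` extends to a minimal generating triple (`x` first) with `spanFinrank 𝔪 = 3` — folklore (Nakayama; cf.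
`exists_span_triple_eq_maximalIdeal` …FrobeniusClosingSteerInsepStepChart, res-type-060's `span_triple_eq_of_mem_sup`). [OURS · SPEC (Δ12) rev 2] [folklore] -/
theorem sigmaPresentationLE3Body_of_bodies (p : ℕ) (hEX : SigmaMaximiserExistsLE3Body p) (hCan : JSigmaCanonicalLE3Body p)
    (hx : ∀ (S : Type) [CommRing S] [IsRegularLocalRing S], ringKrullDim S = (3 : ℕ) →
      ∀ g₁ g₂ : S, IsTwoFlag g₁ g₂ → ∃ x : S, Ideal.span {x, g₂, g₁} = maximalIdeal S ∧ (maximalIdeal S).spanFinrank = 3) :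
    SigmaPresentationLE3Body p := by
  intro k₀ _ _ _ S _ _ _ _ f hdim hf0 hf2 htop hε
  have hε' : iotaEps S f ≠ 1 := by
    rw [hε]
    exact zero_ne_one
  obtain ⟨g₁, g₂, q, r₁, r₂, hmax, hprim⟩ := hEX k₀ S f hdim hf0 hf2 htop hε'
  obtain ⟨x, h𝔪, h3⟩ := hx S hdim g₁ g₂ hmax.2.1
  have hfu : ¬ IsUnit f := (IsLocalRing.mem_maximalIdeal _).mp (Ideal.pow_le_self two_ne_zero hf2)
  have hd : ¬ ringKrullDim S ≤ 2 := by
    rw [hdim]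
    decide
  refine ⟨3, ![x, g₂, g₁], ![q, r₂, r₁], by rw [range_vec₃, h𝔪], h3, ?_, fun m =>
    (jFlatT_eq_weightedMonomialIdeal_of_canonicalAt hf0 hfu htop hd hε' (hCan k₀ S f hdim hf0 hf2 htop hε') hmax hprim h𝔪 m).symm⟩
  intro i
  fin_cases i
  · exact hmax.1.pos.1
  · exact hmax.1.pos.2.1
  · exact hmax.1.pos.2.2

namespace Iota3

variable {S : Type} [CommRing S] [IsLocalRing S]

/-- **PROVED comparison: level-μ dominance ⇒ one-sided dominance of σ-maximisers** (take `a/b := r₁/r₂` of the common triple; the lex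
condition of a σ-maximiser bounds every reached ratio). [OURS · SPEC (Δ12) rev 3] [folklore] -/
theorem sigmaOneSidedDominanceAt_of_atLevel {f : S} (h : TwoFlagDominanceAtLevelAt f) : SigmaOneSidedDominanceAt f := by
  intro g₁ g₂ g₁' g₂' q r₁ r₂ hmax _hprim hmax' _hq
  have hrat : ∀ q' r₁' r₂' : ℕ, AdmissibleTriple q' r₁' r₂' → FlagReaches f (adicOrder f).toNat q' r₁' r₂' → r₁' * r₂ ≤ r₁ * r₂' := by
    intro q' r₁' r₂' hadm hreach
    rcases hmax.2.2.2 q' r₁' r₂' hadm hreach with hlt | ⟨heq, _⟩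
    · exact hlt.le
    · exact heq.le
  exact h r₁ r₂ hmax'.1.pos.2.1 hrat g₁' g₂' g₁ g₂ q r₁ r₂ hmax'.1 rfl hmax'.2.1 hmax.2.1 hmax'.2.2.1 hmax.2.2.1

end Iota3

open Iota3 in
/-- **PROVED: the level-μ body implies the one-sided body** (pointwise `sigmaOneSidedDominanceAt_of_atLevel`). [OURS · SPEC (Δ12) rev 3] [folklore] -/
theorem sigmaOneSidedDominanceLE3Body_of_atLevel (p : ℕ) (h : TwoFlagDominanceAtLevelLE3Body p) : SigmaOneSidedDominanceLE3Body p := by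
  intro k₀ _ _ _ S _ _ _ _ f hdim hf0 hf2 htop hε
  exact sigmaOneSidedDominanceAt_of_atLevel (h k₀ S f hdim hf0 hf2 htop hε)

open Iota3 in
/-- **GLUE (PROVED modulo the ring-level implication `H`): one-sided dominance ≤3 ⇒ (J-can)≤3.**  `H` is EXACTLY res-D-brk-1's
`Iota3.jSigmaCanonicalAt_of_oneSided (hf0) (hfm) (hdom)` (PART 2b), so on its landing `jSigmaCanonicalLE3_of` = this with `H` discharged;
kept as a binder here so the sketch imports only built modules. [OURS · SPEC (Δ12) rev 3] [folklore] -/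
theorem jSigmaCanonicalLE3_of_oneSided_of (p : ℕ)
    (H : ∀ (S : Type) [CommRing S] [IsRegularLocalRing S] (f : S), f ≠ 0 → f ∈ maximalIdeal S →
      SigmaOneSidedDominanceAt f → JSigmaCanonicalAt f)
    (hdom : SigmaOneSidedDominanceLE3Body p) : JSigmaCanonicalLE3Body p := by
  intro k₀ _ _ _ S _ _ _ _ f hdim hf0 hf2 htop hε
  exact H S f hf0 (Ideal.pow_le_self two_ne_zero hf2) (hdom k₀ S f hdim hf0 hf2 htop hε)

open Iota3 in
/-- **BOOKS AFTER rev 3 (PROVED reshuffle): (EX)≤3 + LEVEL-μ DOMINANCE ≤3 (+ `H`, + the r.s.p. completion `hx` = (o70-x) p562089) ⇒ (σ-pres)₃.**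
[OURS · SPEC (Δ12) rev 3] [folklore] -/
theorem sigmaPresentationLE3Body_of_atLevel (p : ℕ) (hEX : SigmaMaximiserExistsLE3Body p) (hDom : TwoFlagDominanceAtLevelLE3Body p)
    (H : ∀ (S : Type) [CommRing S] [IsRegularLocalRing S] (f : S), f ≠ 0 → f ∈ maximalIdeal S →
      SigmaOneSidedDominanceAt f → JSigmaCanonicalAt f)
    (hx : ∀ (S : Type) [CommRing S] [IsRegularLocalRing S], ringKrullDim S = (3 : ℕ) →
      ∀ g₁ g₂ : S, IsTwoFlag g₁ g₂ → ∃ x : S, Ideal.span {x, g₂, g₁} = maximalIdeal S ∧ (maximalIdeal S).spanFinrank = 3) :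
    SigmaPresentationLE3Body p :=
  sigmaPresentationLE3Body_of_bodies p hEX
    (jSigmaCanonicalLE3_of_oneSided_of p H (sigmaOneSidedDominanceLE3Body_of_atLevel p hDom)) hx

/-! ## The binders discharged by the landed theorems (DEAL (F-4) (ii)) -/

namespace Iota3

/-- **`H` BY NAME**: res-D-brk-1's `Iota3.jSigmaCanonicalAt_of_oneSided` (…Iota3JSigmaCanonicalOf) read through the PART-1 names — one-sided dominance at
`q < r₂` gives (J-can) at one `(S, f)`. [OURS · glue] -/
theorem jSigmaCanonicalAt_of_oneSidedDominanceAt :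
    ∀ (S : Type) [CommRing S] [IsRegularLocalRing S] (f : S), f ≠ 0 → f ∈ maximalIdeal S →
      SigmaOneSidedDominanceAt f → JSigmaCanonicalAt f :=
  fun _ _ _ _ hf0 hfm hdom => jSigmaCanonicalAt_of_oneSided hf0 hfm hdom

end Iota3

open Iota3 in
/-- **(o70-a) from the dominance word, BY NAME**: res-D-pv-036's `sigmaMaximiserExistsLE3_of_dominance` (…Iota3SigmaLevelBoundOfDominance) read through
the PART-1 names. [OURS · glue] -/
theorem sigmaMaximiserExistsLE3_of_atLevel (p : ℕ) (hDom : TwoFlagDominanceAtLevelLE3Body p) : SigmaMaximiserExistsLE3Body p :=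
  fun k₀ _ _ _ S _ _ _ _ f hdim hf0 hf2 htop hε =>
    sigmaMaximiserExistsLE3_of_dominance p (fun k₀ _ _ _ S _ _ _ _ f hdim hf0 hf2 htop hε => hDom k₀ S f hdim hf0 hf2 htop hε)
      k₀ S f hdim hf0 hf2 htop hε

open Iota3 in
/-- **(J-can)≤3 FROM THE LEVEL-μ DOMINANCE WORD, nothing else**: `jSigmaCanonicalLE3_of_oneSided_of` with `H` := brk-1's theorem. [OURS · glue] -/
theorem jSigmaCanonicalLE3_of_atLevel (p : ℕ) (hDom : TwoFlagDominanceAtLevelLE3Body p) : JSigmaCanonicalLE3Body p :=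
  jSigmaCanonicalLE3_of_oneSided_of p jSigmaCanonicalAt_of_oneSidedDominanceAt (sigmaOneSidedDominanceLE3Body_of_atLevel p hDom)

open Iota3 in
/-- **(σ-pres)₃ FROM THE LEVEL-μ DOMINANCE WORD, nothing else**: `sigmaPresentationLE3Body_of_atLevel` with `hEX` := 036's
`sigmaMaximiserExistsLE3_of_dominance`, `H` := brk-1's `jSigmaCanonicalAt_of_oneSided`, `hx` := 048's `exists_span_triple_of_isTwoFlag` ((o70-x)).
⇒ RE-ENTRY OBJECT #1 = «prove `TwoFlagDominanceAtLevelLE3Body p`». [OURS · glue] -/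
theorem sigmaPresentationLE3_of_dominance (p : ℕ) (hDom : TwoFlagDominanceAtLevelLE3Body p) : SigmaPresentationLE3Body p :=
  sigmaPresentationLE3Body_of_atLevel p (sigmaMaximiserExistsLE3_of_atLevel p hDom) hDom
    jSigmaCanonicalAt_of_oneSidedDominanceAt exists_span_triple_of_isTwoFlag

end Summit.ResolutionOfSingularities.ResolutionOfSingularities.Cruxes.HypersurfaceCentreConstruction.LocalEngine
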